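import Mathlib
import HarnessLib
import Summits.HubbardSuperconductivity.HubbardSuperconductivity.Theorems.KLProgrammeKLRegimeTwoVolumeSiteKernel
import Summits.HubbardSuperconductivity.HubbardSuperconductivity.Theorems.KLProgrammeKLRegimeTwoVolumeSymInterp

/-!
# K3 ENGINE / VL two-volume read-out, β′ work-order (r4): the EXPLICIT-SYMBOL site-kernel numbers of `τ = (1 − K·ũ)² = (1 + uK)⁻²`,
# `E = K − K²ũ = K/(1 + uK)` — by the RESOLVENT identity in the torus convolution algebra (no derivatives of `τ`, `E`)

Cell gate-hubbard-kl, seat hubbard-kl-k3c5-p1 (g8; (ρ2) resummation lineage).  k3c5-p2's `abs_klLocalPart_sub_le_resummed` (…TwoVolumeResummedReadout)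
reads `‖τ̌‖₁`, `M₁(τ̌)` and the far tail of `c_{Re E}` of the SAMPLED symbols `τ(p) = (1 − K(p)·(u(p)/(1 + u(p)K(p))))²`,
`E(p) = K(p) − K(p)²·(u(p)/(1 + u(p)K(p)))`.  With `g := u·K`, `r := (1 + g)⁻¹`: `τ = r²`, `E = K·r` exactly, and `r = 1 − g·r` pointwise; since
`torusFourierInv` maps products to convolutions ([tree] `torusFourierInv_mul_eq_conv`) and `‖·‖₁`, `M₁ = Σ tnorm·‖·‖` are (sub)multiplicative under
convolution ([tree] `sum_norm_conv_le`, `sum_tnorm_norm_conv_le`), with `a := ‖ǧ‖₁ < 1` (no pointwise smallness beyond `1 + g ≠ 0`):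
§1 `torusFourierInv 1 = δ₀` (`‖·‖₁ = 1`, `M₁ = 0`), linearity, product bounds; §2 **`sum_norm_torusFourierInv_resolvent_le`** `‖ř‖₁ ≤ 1/(1 − a)`,
**`sum_tnorm_norm_torusFourierInv_resolvent_le`** `M₁(ř) ≤ M₁(ǧ)/(1 − a)²`; §3 **`…_tau_le`** `‖τ̌‖₁ ≤ 1/(1 − a)²`, `M₁(τ̌) ≤ 2M₁(ǧ)/(1 − a)³`,
**`…_E_le`** `‖Ě‖₁ ≤ ‖Ǩ‖₁/(1 − a)`, `M₁(Ě) ≤ M₁(Ǩ)/(1 − a) + ‖Ǩ‖₁M₁(ǧ)/(1 − a)²`; §4 `‖(Re f)ˇ(x)‖ ≤ (‖f̌(x)‖ + ‖f̌(−x)‖)/2`, `M₁((Re f)ˇ) ≤ M₁(f̌)`,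
**`sum_far_abs_torusCosCoeff_re_E_le`**: `Σ_{y ≠ clift(red y)} |c_{Re E}(y)| ≤ M₁(Ě)-bound/((Lc−1)/2+1)`.
All statements are about lattice data `u, K : TorusSite d L → ℂ` (the consumer instantiates `u k = u(p_k)`, `K k = K.eval(p_k)`; `‖Ǩ‖₁`, `M₁(Ǩ)` are
[tree] p3's framePosKernel bounds, `‖ǔ‖₁`, `M₁(ǔ)` come from `…SampledPeriodicSymbolKernelL1(Deriv)`).  Flowing scheme at scale `0` (`K₀ = 0`):
`g = 0`, `τ̌ = δ₀`, `Ě = 0`.  Proofs only; no definitions; nothing about the model.  References: Friedli–Velenik 2017 §10.4; BGM 2006 (2.23).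
-/

noncomputable section

namespace Summit.HubbardSuperconductivity.HubbardSuperconductivity.Theorems.TwoVolumeDefect

set_option linter.dupNamespace false -- summit = problem name (single-conjunct summit), D-0017

open Finset Complex Literature.MathematicalPhysics.QuantumLattice Literature.Probability.LatticeModels
open Summit.HubbardSuperconductivity.HubbardSuperconductivity.Theorems.KLRegimeSplit
open scoped ComplexConjugate

/-! ## §1 The unit of the convolution algebra and linearity of `torusFourierInv` -/
section Unit

variable {d L : ℕ} [NeZero L]

/-- `torusFourierInv 1 = δ₀`. -/
theorem torusFourierInv_const_one (x : TorusSite d L) :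
    torusFourierInv (fun _ : TorusSite d L => (1 : ℂ)) x = if x = 0 then 1 else 0 := by
  classical
  have hL : ((L : ℂ) ^ d) ≠ 0 := pow_ne_zero _ (Nat.cast_ne_zero.2 (NeZero.ne L))
  rw [torusFourierInv_eq_sum_torusChar]
  simp_rw [one_mul]
  rw [sum_torusChar_left]
  split_ifs <;> simp [hL]

/-- `‖δ₀‖₁ = 1`. -/
theorem sum_norm_torusFourierInv_const_one : ∑ x : TorusSite d L, ‖torusFourierInv (fun _ : TorusSite d L => (1 : ℂ)) x‖ = 1 := by
  classical
  simp_rw [torusFourierInv_const_one]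
  rw [Finset.sum_eq_single (0 : TorusSite d L)]
  · simp
  · intro b _ hb; simp [hb]
  · intro h; exact absurd (mem_univ _) h

/-- The torus sup-norm of `0` vanishes. -/
theorem tnorm_zero' : Torus.tnorm (0 : TorusSite d L) = 0 := by
  have h : Torus.tnorm (0 : TorusSite d L) ≤ Site.supNorm (0 : Site d) := by
    have := Torus.tnorm_proj_le (L := L) (0 : Site d)
    have h0 : Torus.proj L (0 : Site d) = 0 := by funext i; simp [Torus.proj_apply]
    rwa [h0] at this
  have h2 : Site.supNorm (0 : Site d) = 0 := by
    apply Nat.le_zero.1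
    exact Site.supNorm_le_iff.2 fun i => by simp
  omega

/-- `M₁(δ₀) = 0`. -/
theorem sum_tnorm_norm_torusFourierInv_const_one :
    ∑ x : TorusSite d L, (Torus.tnorm x : ℝ) * ‖torusFourierInv (fun _ : TorusSite d L => (1 : ℂ)) x‖ = 0 := by
  classical
  simp_rw [torusFourierInv_const_one]
  refine Finset.sum_eq_zero fun x _ => ?_
  by_cases hx : x = 0
  · subst hx; simp [tnorm_zero']
  · simp [hx]

/-- Linearity: `torusFourierInv (f − h) = torusFourierInv f − torusFourierInv h`. -/
theorem torusFourierInv_sub' (f h : TorusSite d L → ℂ) (x : TorusSite d L) :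
    torusFourierInv (fun k => f k - h k) x = torusFourierInv f x - torusFourierInv h x := by
  simp only [torusFourierInv_eq_sum_torusChar, sub_mul, Finset.sum_sub_distrib, mul_sub]

/-- `torusFourierInv` of a scalar multiple. -/
theorem torusFourierInv_const_mul (c : ℂ) (f : TorusSite d L → ℂ) (x : TorusSite d L) :
    torusFourierInv (fun k => c * f k) x = c * torusFourierInv f x := by
  simp only [torusFourierInv_eq_sum_torusChar, mul_assoc, ← Finset.mul_sum]
  ring

/-- Products of lattice data have `ℓ¹`-submultiplicative position kernels: `‖(f·h)ˇ‖₁ ≤ ‖f̌‖₁·‖ȟ‖₁`. -/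
theorem sum_norm_torusFourierInv_mul_le (f h : TorusSite d L → ℂ) :
    ∑ x : TorusSite d L, ‖torusFourierInv (fun k => f k * h k) x‖ ≤
      (∑ x : TorusSite d L, ‖torusFourierInv f x‖) * ∑ x : TorusSite d L, ‖torusFourierInv h x‖ := by
  simp_rw [torusFourierInv_mul_eq_conv]
  exact sum_norm_conv_le _ _

/-- First `tnorm`-moment of a product: `M₁((f·h)ˇ) ≤ M₁(f̌)‖ȟ‖₁ + ‖f̌‖₁M₁(ȟ)`. -/
theorem sum_tnorm_norm_torusFourierInv_mul_le (f h : TorusSite d L → ℂ) :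
    ∑ x : TorusSite d L, (Torus.tnorm x : ℝ) * ‖torusFourierInv (fun k => f k * h k) x‖ ≤
      (∑ x : TorusSite d L, (Torus.tnorm x : ℝ) * ‖torusFourierInv f x‖) * (∑ x : TorusSite d L, ‖torusFourierInv h x‖) +
        (∑ x : TorusSite d L, ‖torusFourierInv f x‖) * ∑ x : TorusSite d L, (Torus.tnorm x : ℝ) * ‖torusFourierInv h x‖ := by
  simp_rw [torusFourierInv_mul_eq_conv]
  exact sum_tnorm_norm_conv_le _ _

end Unit

/-! ## §2 The resolvent bound in the convolution algebra -/
section Resolvent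

variable {d L : ℕ} [NeZero L] {r g : TorusSite d L → ℂ}

omit [NeZero L] in
/-- The resolvent equation pointwise: `r·(1 + g) = 1` gives `r = 1 − g·r`. -/
theorem resolvent_eq_one_sub (hr : ∀ k, r k * (1 + g k) = 1) (k : TorusSite d L) : r k = 1 - g k * r k := by
  have h := hr k
  linear_combination h

/-- **`‖ř‖₁ ≤ 1/(1 − ‖ǧ‖₁)`**: if `r·(1+g) = 1` pointwise and `a := ‖ǧ‖₁ < 1` then `‖ř‖₁ ≤ 1/(1 − a)`
(`ř = δ₀ − ǧ ∗ ř`, Young). -/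
theorem sum_norm_torusFourierInv_resolvent_le (hr : ∀ k, r k * (1 + g k) = 1) {a : ℝ}
    (ha : ∑ x : TorusSite d L, ‖torusFourierInv g x‖ ≤ a) (ha1 : a < 1) :
    ∑ x : TorusSite d L, ‖torusFourierInv r x‖ ≤ 1 / (1 - a) := by
  set S := ∑ x : TorusSite d L, ‖torusFourierInv r x‖ with hS
  have hS0 : 0 ≤ S := sum_nonneg fun x _ => norm_nonneg _
  have hrepr : ∀ x, torusFourierInv r x =
      torusFourierInv (fun _ : TorusSite d L => (1 : ℂ)) x - torusFourierInv (fun k => g k * r k) x := by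
    intro x
    rw [← torusFourierInv_sub']
    congr 1
    funext k
    exact resolvent_eq_one_sub hr k
  have h1 : S ≤ 1 + a * S := by
    calc S = ∑ x : TorusSite d L, ‖torusFourierInv (fun _ : TorusSite d L => (1 : ℂ)) x -
          torusFourierInv (fun k => g k * r k) x‖ := by
          rw [hS]; exact sum_congr rfl fun x _ => by rw [hrepr]
      _ ≤ ∑ x : TorusSite d L, (‖torusFourierInv (fun _ : TorusSite d L => (1 : ℂ)) x‖ +
          ‖torusFourierInv (fun k => g k * r k) x‖) := sum_le_sum fun x _ => norm_sub_le _ _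
      _ = 1 + ∑ x : TorusSite d L, ‖torusFourierInv (fun k => g k * r k) x‖ := by
          rw [sum_add_distrib, sum_norm_torusFourierInv_const_one]
      _ ≤ 1 + (∑ x : TorusSite d L, ‖torusFourierInv g x‖) * S :=
          add_le_add le_rfl (sum_norm_torusFourierInv_mul_le g r)
      _ ≤ 1 + a * S := by gcongr
  have h2 : (1 - a) * S ≤ 1 := by nlinarith
  rw [le_div_iff₀ (by linarith)]
  linarith

/-- **`M₁(ř) ≤ M₁(ǧ)/(1 − ‖ǧ‖₁)²`** (`ř = δ₀ − ǧ ∗ ř`, the first moment of a convolution). -/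
theorem sum_tnorm_norm_torusFourierInv_resolvent_le (hr : ∀ k, r k * (1 + g k) = 1) {a m : ℝ}
    (ha : ∑ x : TorusSite d L, ‖torusFourierInv g x‖ ≤ a) (ha1 : a < 1)
    (hm : ∑ x : TorusSite d L, (Torus.tnorm x : ℝ) * ‖torusFourierInv g x‖ ≤ m) :
    ∑ x : TorusSite d L, (Torus.tnorm x : ℝ) * ‖torusFourierInv r x‖ ≤ m / (1 - a) ^ 2 := by
  set S := ∑ x : TorusSite d L, ‖torusFourierInv r x‖ with hS
  set T := ∑ x : TorusSite d L, (Torus.tnorm x : ℝ) * ‖torusFourierInv r x‖ with hT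
  have hS0 : 0 ≤ S := sum_nonneg fun x _ => norm_nonneg _
  have hT0 : 0 ≤ T := sum_nonneg fun x _ => mul_nonneg (Nat.cast_nonneg _) (norm_nonneg _)
  have ha0 : 0 ≤ a := le_trans (sum_nonneg fun x _ => norm_nonneg _) ha
  have hm0 : 0 ≤ m := le_trans (sum_nonneg fun x _ => mul_nonneg (Nat.cast_nonneg _) (norm_nonneg _)) hm
  have hSle : S ≤ 1 / (1 - a) := sum_norm_torusFourierInv_resolvent_le hr ha ha1
  have hrepr : ∀ x, torusFourierInv r x =
      torusFourierInv (fun _ : TorusSite d L => (1 : ℂ)) x - torusFourierInv (fun k => g k * r k) x := by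
    intro x
    rw [← torusFourierInv_sub']
    congr 1
    funext k
    exact resolvent_eq_one_sub hr k
  have h1 : T ≤ m * S + a * T := by
    calc T = ∑ x : TorusSite d L, (Torus.tnorm x : ℝ) * ‖torusFourierInv (fun _ : TorusSite d L => (1 : ℂ)) x -
          torusFourierInv (fun k => g k * r k) x‖ := by
          rw [hT]; exact sum_congr rfl fun x _ => by rw [hrepr]
      _ ≤ ∑ x : TorusSite d L, ((Torus.tnorm x : ℝ) * ‖torusFourierInv (fun _ : TorusSite d L => (1 : ℂ)) x‖ +
          (Torus.tnorm x : ℝ) * ‖torusFourierInv (fun k => g k * r k) x‖) :=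
          sum_le_sum fun x _ => by
            rw [← mul_add]
            exact mul_le_mul_of_nonneg_left (norm_sub_le _ _) (Nat.cast_nonneg _)
      _ = ∑ x : TorusSite d L, (Torus.tnorm x : ℝ) * ‖torusFourierInv (fun k => g k * r k) x‖ := by
          rw [sum_add_distrib, sum_tnorm_norm_torusFourierInv_const_one, zero_add]
      _ ≤ (∑ x : TorusSite d L, (Torus.tnorm x : ℝ) * ‖torusFourierInv g x‖) * S +
          (∑ x : TorusSite d L, ‖torusFourierInv g x‖) * T := sum_tnorm_norm_torusFourierInv_mul_le g r
      _ ≤ m * S + a * T := by gcongr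
  have h2 : (1 - a) * T ≤ m * S := by nlinarith
  have h3 : m * S ≤ m * (1 / (1 - a)) := mul_le_mul_of_nonneg_left hSle hm0
  have h1a : 0 < 1 - a := by linarith
  rw [le_div_iff₀ (by positivity)]
  calc T * (1 - a) ^ 2 = ((1 - a) * T) * (1 - a) := by ring
    _ ≤ (m * (1 / (1 - a))) * (1 - a) := mul_le_mul_of_nonneg_right (h2.trans h3) h1a.le
    _ = m := by field_simp

end Resolvent

/-! ## §3 The resummed symbols `τ = (1 − K·ũ)²`, `E = K − K²·ũ`, `ũ = u/(1 + uK)` -/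
section Symbols

variable {d L : ℕ} [NeZero L] (u K : TorusSite d L → ℂ) (hden : ∀ k, 1 + u k * K k ≠ 0)
include hden

omit [NeZero L] in
/-- `1 − K·(u/(1 + uK)) = (1 + uK)⁻¹`. -/
theorem one_sub_mul_div_eq (k : TorusSite d L) : 1 - K k * (u k / (1 + u k * K k)) = (1 + u k * K k)⁻¹ := by
  have h := hden k
  have h' : 1 + K k * u k ≠ 0 := by rw [mul_comm]; exact h
  rw [div_eq_mul_inv]
  field_simp
  ring

omit [NeZero L] in
/-- `τ = (1 − K·ũ)² = ((1 + uK)⁻¹)²`. -/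
theorem sq_one_sub_mul_div_eq (k : TorusSite d L) : (1 - K k * (u k / (1 + u k * K k))) ^ 2 = ((1 + u k * K k)⁻¹) ^ 2 := by
  rw [one_sub_mul_div_eq u K hden]

omit [NeZero L] in
/-- `E = K − K²·ũ = K·(1 + uK)⁻¹`. -/
theorem sub_sq_mul_div_eq (k : TorusSite d L) : K k - K k ^ 2 * (u k / (1 + u k * K k)) = K k * (1 + u k * K k)⁻¹ := by
  have h := hden k
  have h' : 1 + K k * u k ≠ 0 := by rw [mul_comm]; exact h
  rw [div_eq_mul_inv]
  field_simp
  ring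

omit [NeZero L] in
/-- The resolvent `r = (1 + uK)⁻¹` solves `r·(1 + g) = 1` with `g = u·K`. -/
theorem inv_mul_one_add (k : TorusSite d L) : (1 + u k * K k)⁻¹ * (1 + u k * K k) = 1 := inv_mul_cancel₀ (hden k)

variable {u K}

/-- **`‖τ̌‖₁ ≤ 1/(1 − a)²`**, `a ≥ ‖(uK)ˇ‖₁`, `a < 1`. -/
theorem sum_norm_torusFourierInv_tau_le {a : ℝ} (ha : ∑ x : TorusSite d L, ‖torusFourierInv (fun k => u k * K k) x‖ ≤ a)
    (ha1 : a < 1) :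
    ∑ x : TorusSite d L, ‖torusFourierInv (fun k => (1 - K k * (u k / (1 + u k * K k))) ^ 2) x‖ ≤ 1 / (1 - a) ^ 2 := by
  have hr := sum_norm_torusFourierInv_resolvent_le (r := fun k => (1 + u k * K k)⁻¹) (g := fun k => u k * K k)
    (fun k => inv_mul_one_add u K hden k) ha ha1
  have hτ : (fun k => (1 - K k * (u k / (1 + u k * K k))) ^ 2) = fun k => (1 + u k * K k)⁻¹ * (1 + u k * K k)⁻¹ := by
    funext k; rw [sq_one_sub_mul_div_eq u K hden, sq]
  rw [hτ]
  have h0 : 0 ≤ ∑ x : TorusSite d L, ‖torusFourierInv (fun k => (1 + u k * K k)⁻¹) x‖ := sum_nonneg fun x _ => norm_nonneg _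
  have h1a : 0 < 1 - a := by linarith
  calc _ ≤ (∑ x : TorusSite d L, ‖torusFourierInv (fun k => (1 + u k * K k)⁻¹) x‖) *
        ∑ x : TorusSite d L, ‖torusFourierInv (fun k => (1 + u k * K k)⁻¹) x‖ := sum_norm_torusFourierInv_mul_le _ _
    _ ≤ (1 / (1 - a)) * (1 / (1 - a)) := mul_le_mul hr hr h0 (by positivity)
    _ = 1 / (1 - a) ^ 2 := by field_simp

/-- **`M₁(τ̌) ≤ 2M₁((uK)ˇ)/(1 − a)³`.** -/
theorem sum_tnorm_norm_torusFourierInv_tau_le {a m : ℝ} (ha : ∑ x : TorusSite d L, ‖torusFourierInv (fun k => u k * K k) x‖ ≤ a)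
    (ha1 : a < 1) (hm : ∑ x : TorusSite d L, (Torus.tnorm x : ℝ) * ‖torusFourierInv (fun k => u k * K k) x‖ ≤ m) :
    ∑ x : TorusSite d L, (Torus.tnorm x : ℝ) * ‖torusFourierInv (fun k => (1 - K k * (u k / (1 + u k * K k))) ^ 2) x‖ ≤
      2 * m / (1 - a) ^ 3 := by
  have hr := sum_norm_torusFourierInv_resolvent_le (r := fun k => (1 + u k * K k)⁻¹) (g := fun k => u k * K k)
    (fun k => inv_mul_one_add u K hden k) ha ha1
  have hrm := sum_tnorm_norm_torusFourierInv_resolvent_le (r := fun k => (1 + u k * K k)⁻¹) (g := fun k => u k * K k)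
    (fun k => inv_mul_one_add u K hden k) ha ha1 hm
  have hτ : (fun k => (1 - K k * (u k / (1 + u k * K k))) ^ 2) = fun k => (1 + u k * K k)⁻¹ * (1 + u k * K k)⁻¹ := by
    funext k; rw [sq_one_sub_mul_div_eq u K hden, sq]
  rw [hτ]
  set S := ∑ x : TorusSite d L, ‖torusFourierInv (fun k => (1 + u k * K k)⁻¹) x‖
  set T := ∑ x : TorusSite d L, (Torus.tnorm x : ℝ) * ‖torusFourierInv (fun k => (1 + u k * K k)⁻¹) x‖
  have hS0 : 0 ≤ S := sum_nonneg fun x _ => norm_nonneg _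
  have hT0 : 0 ≤ T := sum_nonneg fun x _ => mul_nonneg (Nat.cast_nonneg _) (norm_nonneg _)
  have hm0 : 0 ≤ m := le_trans (sum_nonneg fun x _ => mul_nonneg (Nat.cast_nonneg _) (norm_nonneg _)) hm
  have h1a : 0 < 1 - a := by linarith
  calc _ ≤ T * S + S * T := sum_tnorm_norm_torusFourierInv_mul_le _ _
    _ ≤ (m / (1 - a) ^ 2) * (1 / (1 - a)) + (1 / (1 - a)) * (m / (1 - a) ^ 2) := by
        gcongr
    _ = 2 * m / (1 - a) ^ 3 := by rw [pow_succ]; field_simp; ring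

/-- **`‖Ě‖₁ ≤ ‖Ǩ‖₁/(1 − a)`.** -/
theorem sum_norm_torusFourierInv_E_le {a κ : ℝ} (ha : ∑ x : TorusSite d L, ‖torusFourierInv (fun k => u k * K k) x‖ ≤ a)
    (ha1 : a < 1) (hκ : ∑ x : TorusSite d L, ‖torusFourierInv K x‖ ≤ κ) :
    ∑ x : TorusSite d L, ‖torusFourierInv (fun k => K k - K k ^ 2 * (u k / (1 + u k * K k))) x‖ ≤ κ / (1 - a) := by
  have hr := sum_norm_torusFourierInv_resolvent_le (r := fun k => (1 + u k * K k)⁻¹) (g := fun k => u k * K k)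
    (fun k => inv_mul_one_add u K hden k) ha ha1
  have hE : (fun k => K k - K k ^ 2 * (u k / (1 + u k * K k))) = fun k => K k * (1 + u k * K k)⁻¹ := by
    funext k; exact sub_sq_mul_div_eq u K hden k
  rw [hE]
  have hκ0 : 0 ≤ κ := le_trans (sum_nonneg fun x _ => norm_nonneg _) hκ
  have h1a : 0 < 1 - a := by linarith
  calc _ ≤ (∑ x : TorusSite d L, ‖torusFourierInv K x‖) * ∑ x : TorusSite d L, ‖torusFourierInv (fun k => (1 + u k * K k)⁻¹) x‖ :=
        sum_norm_torusFourierInv_mul_le _ _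
    _ ≤ κ * (1 / (1 - a)) := mul_le_mul hκ hr (sum_nonneg fun x _ => norm_nonneg _) hκ0
    _ = κ / (1 - a) := by field_simp

/-- **`M₁(Ě) ≤ M₁(Ǩ)/(1 − a) + ‖Ǩ‖₁·M₁((uK)ˇ)/(1 − a)²`.** -/
theorem sum_tnorm_norm_torusFourierInv_E_le {a m κ κ₁ : ℝ}
    (ha : ∑ x : TorusSite d L, ‖torusFourierInv (fun k => u k * K k) x‖ ≤ a) (ha1 : a < 1)
    (hm : ∑ x : TorusSite d L, (Torus.tnorm x : ℝ) * ‖torusFourierInv (fun k => u k * K k) x‖ ≤ m)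
    (hκ : ∑ x : TorusSite d L, ‖torusFourierInv K x‖ ≤ κ)
    (hκ₁ : ∑ x : TorusSite d L, (Torus.tnorm x : ℝ) * ‖torusFourierInv K x‖ ≤ κ₁) :
    ∑ x : TorusSite d L, (Torus.tnorm x : ℝ) * ‖torusFourierInv (fun k => K k - K k ^ 2 * (u k / (1 + u k * K k))) x‖ ≤
      κ₁ / (1 - a) + κ * m / (1 - a) ^ 2 := by
  have hr := sum_norm_torusFourierInv_resolvent_le (r := fun k => (1 + u k * K k)⁻¹) (g := fun k => u k * K k)
    (fun k => inv_mul_one_add u K hden k) ha ha1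
  have hrm := sum_tnorm_norm_torusFourierInv_resolvent_le (r := fun k => (1 + u k * K k)⁻¹) (g := fun k => u k * K k)
    (fun k => inv_mul_one_add u K hden k) ha ha1 hm
  have hE : (fun k => K k - K k ^ 2 * (u k / (1 + u k * K k))) = fun k => K k * (1 + u k * K k)⁻¹ := by
    funext k; exact sub_sq_mul_div_eq u K hden k
  rw [hE]
  have hκ0 : 0 ≤ κ := le_trans (sum_nonneg fun x _ => norm_nonneg _) hκ
  have hκ₁0 : 0 ≤ κ₁ := le_trans (sum_nonneg fun x _ => mul_nonneg (Nat.cast_nonneg _) (norm_nonneg _)) hκ₁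
  have hm0 : 0 ≤ m := le_trans (sum_nonneg fun x _ => mul_nonneg (Nat.cast_nonneg _) (norm_nonneg _)) hm
  have h1a : 0 < 1 - a := by linarith
  calc _ ≤ (∑ x : TorusSite d L, (Torus.tnorm x : ℝ) * ‖torusFourierInv K x‖) *
          (∑ x : TorusSite d L, ‖torusFourierInv (fun k => (1 + u k * K k)⁻¹) x‖) +
        (∑ x : TorusSite d L, ‖torusFourierInv K x‖) *
          ∑ x : TorusSite d L, (Torus.tnorm x : ℝ) * ‖torusFourierInv (fun k => (1 + u k * K k)⁻¹) x‖ :=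
        sum_tnorm_norm_torusFourierInv_mul_le _ _
    _ ≤ κ₁ * (1 / (1 - a)) + κ * (m / (1 - a) ^ 2) := by
        gcongr
    _ = κ₁ / (1 - a) + κ * m / (1 - a) ^ 2 := by field_simp

end Symbols

/-! ## §4 The real part and the far tail of `c_{Re E}` -/
section RealPart

variable {d L : ℕ} [NeZero L]

/-- `(conj f)ˇ(x) = conj (f̌(−x))`. -/
theorem torusFourierInv_conj (f : TorusSite d L → ℂ) (x : TorusSite d L) :
    torusFourierInv (fun k => conj (f k)) x = conj (torusFourierInv f (-x)) := by
  rw [torusFourierInv_eq_sum_torusChar, torusFourierInv_eq_sum_torusChar, map_mul, map_sum]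
  congr 1
  · rw [map_inv₀, map_pow, Complex.conj_natCast]
  · refine sum_congr rfl fun k _ => ?_
    rw [map_mul, torusChar_neg_right, Complex.conj_conj]

/-- **The kernel of a real part**: `‖(Re f : ℂ)ˇ(x)‖ ≤ (‖f̌(x)‖ + ‖f̌(−x)‖)/2`. -/
theorem norm_torusFourierInv_re_le (f : TorusSite d L → ℂ) (x : TorusSite d L) :
    ‖torusFourierInv (fun k => (((f k).re : ℝ) : ℂ)) x‖ ≤ (‖torusFourierInv f x‖ + ‖torusFourierInv f (-x)‖) / 2 := by
  have hre : (fun k => (((f k).re : ℝ) : ℂ)) = fun k => (1 / 2 : ℂ) * (f k + conj (f k)) := by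
    funext k
    rw [Complex.add_conj, Complex.ofReal_mul, Complex.ofReal_ofNat]
    ring
  have hlin : torusFourierInv (fun k => (1 / 2 : ℂ) * (f k + conj (f k))) x =
      (1 / 2 : ℂ) * (torusFourierInv f x + torusFourierInv (fun k => conj (f k)) x) := by
    rw [torusFourierInv_const_mul]
    congr 1
    simp only [torusFourierInv_eq_sum_torusChar, add_mul, Finset.sum_add_distrib, mul_add]
  rw [hre, hlin, torusFourierInv_conj, norm_mul]
  have h12 : ‖(1 / 2 : ℂ)‖ = 1 / 2 := by simp
  rw [h12]
  have := norm_add_le (torusFourierInv f x) (conj (torusFourierInv f (-x)))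
  rw [Complex.norm_conj] at this
  linarith

/-- **First `tnorm`-moment of the kernel of a real part**: `M₁((Re f)ˇ) ≤ M₁(f̌)`. -/
theorem sum_tnorm_norm_torusFourierInv_re_le (f : TorusSite d L → ℂ) :
    ∑ x : TorusSite d L, (Torus.tnorm x : ℝ) * ‖torusFourierInv (fun k => (((f k).re : ℝ) : ℂ)) x‖ ≤
      ∑ x : TorusSite d L, (Torus.tnorm x : ℝ) * ‖torusFourierInv f x‖ := by
  have hneg : ∑ x : TorusSite d L, (Torus.tnorm x : ℝ) * ‖torusFourierInv f (-x)‖ ≤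
      ∑ x : TorusSite d L, (Torus.tnorm x : ℝ) * ‖torusFourierInv f x‖ := by
    have h1 : ∑ x : TorusSite d L, (Torus.tnorm x : ℝ) * ‖torusFourierInv f (-x)‖ =
        ∑ y : TorusSite d L, (Torus.tnorm (-y) : ℝ) * ‖torusFourierInv f y‖ :=
      Fintype.sum_equiv (Equiv.neg _) _ _ fun x => by simp
    rw [h1]
    exact sum_le_sum fun y _ => mul_le_mul_of_nonneg_right (by exact_mod_cast Torus.tnorm_neg_le y) (norm_nonneg _)
  calc _ ≤ ∑ x : TorusSite d L, (Torus.tnorm x : ℝ) * ((‖torusFourierInv f x‖ + ‖torusFourierInv f (-x)‖) / 2) :=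
        sum_le_sum fun x _ => mul_le_mul_of_nonneg_left (norm_torusFourierInv_re_le f x) (Nat.cast_nonneg _)
    _ = ((∑ x : TorusSite d L, (Torus.tnorm x : ℝ) * ‖torusFourierInv f x‖) +
          ∑ x : TorusSite d L, (Torus.tnorm x : ℝ) * ‖torusFourierInv f (-x)‖) / 2 := by
        rw [← sum_add_distrib, Finset.sum_div]
        exact sum_congr rfl fun x _ => by ring
    _ ≤ _ := by linarith

end RealPart

section Far

variable {b Lc Lf : ℕ} [NeZero Lc] [NeZero Lf]

/-- **The far tail of the cosine coefficients of a real part is paid by the first moment of the complex kernel**: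
`Σ_{y ≠ clift(red y)} |c_{Re f}(y)| ≤ M₁(f̌)/((Lc−1)/2+1)` for `Lf = b·Lc`. -/
theorem sum_far_abs_torusCosCoeff_re_le (hL : Lf = b * Lc) (f : TorusSite 2 Lf → ℂ) :
    ∑ y ∈ univ.filter (fun y : TorusSite 2 Lf => Torus.proj Lf (Torus.cRep (fun i => (((y i).val : ℕ) : ZMod Lc))) ≠ y),
        |torusCosCoeff Lf (fun k => (f k).re) y| ≤
      (∑ y : TorusSite 2 Lf, (Torus.tnorm y : ℝ) * ‖torusFourierInv f y‖) / (((Lc - 1) / 2 + 1 : ℕ) : ℝ) := by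
  have h1 : ∀ y, |torusCosCoeff Lf (fun k => (f k).re) y| ≤ ‖torusFourierInv (fun k => (((f k).re : ℝ) : ℂ)) y‖ := by
    intro y
    rw [torusCosCoeff_eq_re_torusFourierInv]
    exact Complex.abs_re_le_norm _
  calc _ ≤ ∑ y ∈ univ.filter (fun y : TorusSite 2 Lf => Torus.proj Lf (Torus.cRep (fun i => (((y i).val : ℕ) : ZMod Lc))) ≠ y),
        ‖torusFourierInv (fun k => (((f k).re : ℝ) : ℂ)) y‖ := sum_le_sum fun y _ => h1 y
    _ ≤ (∑ y : TorusSite 2 Lf, (Torus.tnorm y : ℝ) * ‖torusFourierInv (fun k => (((f k).re : ℝ) : ℂ)) y‖) /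
          (((Lc - 1) / 2 + 1 : ℕ) : ℝ) := sum_far_norm_le_firstMoment_tnorm hL _
    _ ≤ _ := div_le_div_of_nonneg_right (sum_tnorm_norm_torusFourierInv_re_le f) (by positivity)

/-- **The far tail of `c_{Re E}`**, `E = K − K²·(u/(1 + uK))`: `≤ (κ₁/(1 − a) + κ·m/(1 − a)²)/((Lc−1)/2+1)`. -/
theorem sum_far_abs_torusCosCoeff_re_E_le (hL : Lf = b * Lc) {u K : TorusSite 2 Lf → ℂ} (hden : ∀ k, 1 + u k * K k ≠ 0)
    {a m κ κ₁ : ℝ} (ha : ∑ x : TorusSite 2 Lf, ‖torusFourierInv (fun k => u k * K k) x‖ ≤ a) (ha1 : a < 1)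
    (hm : ∑ x : TorusSite 2 Lf, (Torus.tnorm x : ℝ) * ‖torusFourierInv (fun k => u k * K k) x‖ ≤ m)
    (hκ : ∑ x : TorusSite 2 Lf, ‖torusFourierInv K x‖ ≤ κ)
    (hκ₁ : ∑ x : TorusSite 2 Lf, (Torus.tnorm x : ℝ) * ‖torusFourierInv K x‖ ≤ κ₁) :
    ∑ y ∈ univ.filter (fun y : TorusSite 2 Lf => Torus.proj Lf (Torus.cRep (fun i => (((y i).val : ℕ) : ZMod Lc))) ≠ y),
        |torusCosCoeff Lf (fun k => (K k - K k ^ 2 * (u k / (1 + u k * K k))).re) y| ≤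
      (κ₁ / (1 - a) + κ * m / (1 - a) ^ 2) / (((Lc - 1) / 2 + 1 : ℕ) : ℝ) :=
  (sum_far_abs_torusCosCoeff_re_le hL _).trans
    (div_le_div_of_nonneg_right (sum_tnorm_norm_torusFourierInv_E_le hden ha ha1 hm hκ hκ₁) (by positivity))

end Far

end Summit.HubbardSuperconductivity.HubbardSuperconductivity.Theorems.TwoVolumeDefect
end
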